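import Literature.Computability.AlgebraicComplexity.BLMW11InvariantDimensionTransport
import Literature.NumberTheory.DiophantineGeometry.DetStabilizerFrobeniusProofs
import Literature.RepresentationTheory.GeneralLinear.WordRaisingOperator
import Mathlib.LinearAlgebra.Matrix.Transvection
import HarnessLib

/-!
# BLMW 2011, Prop. 5.2.1 (5.2.6): `dim (S_π(E ⊗ F))^{GL(W)(det_n)} = sk^π_{δⁿδⁿ}` — discharge of
# `BLMW2011_prop_5_2_1_invariants`

Cell `val-lit` (D-0074 GROUP L), row BLMW11-A, discharge duty. P. Bürgisser, J. M. Landsberg,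
L. Manivel, J. Weyman, *An overview of mathematical issues arising in the geometric complexity
theory approach to VP ≠ VNP*, SIAM J. Comput. 40(4) (2011) 1179–1209 = arXiv:0907.2850, §5.2,
Prop. 5.2.1: "`ℂ[GL(W)·det_n] = ⊕_{δ ≥ 0} ⊕_{π : |π| = nδ} (S_πW^*)^{⊕ sk^π_{δⁿδⁿ}}`" ((5.2.6),
`W = E ⊗ F`, `E = F = ℂⁿ`), established in the printed proof as "`dim (S_π(E ⊗ F))^H = sk^π_{δⁿδⁿ}`
… Moreover, if `n` does not divide `|π|`, then `(S_π(E ⊗ F))^{H₀} = 0`", `H = GL(W)(det_n) =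
H₀ ⋊ ℤ₂`, `H₀ = S(GL(E) × GL(F))` ((5.2.1), Frobenius). The parent file
`BLMW11StabilityInheritance.lean` types this as the named fact `BLMW2011_prop_5_2_1_invariants`
(dimension of the `linStabilizer (detFormLex ℂ n)`-invariants of `schurRep (stdRep (MatIdx n) ℂ) π`
equals `symKroneckerCoeff ℂ π (δⁿ)` for `π ⊢ nδ`, `ℓ(π) ≤ n²`; invariants `= ⊥` when `n ∤ |π|`). This
file PROVES it (`BLMW2011_prop_5_2_1_invariants_holds`). Theorems only: no definitions, no named
facts. Honest framing: a classical representation-theoretic computation (the det side of BLMW's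
multiplicity comparison); VP ≠ VNP is NOT proved and nothing here is progress on it.

## What was already in the tree, and what this file adds

* `≤`: t08's `IK2020.weylInvariantDim_det_le_symKroneckerCoeffRect` (`dim {λ}^H = dim T_H`,
  `IK2020.finrank_boundSpace_invariants_eq_weylInvariantDim`, and every `H`-fixed tensor is fixed by
  the stabilizing family `S` = {unimodular upper triangular `a ⊗ b`} ∪ {`τ`} whose fixed space `X'` =
  `symKronInvariants` DEFINES `symKroneckerCoeffRect = dim T_S`, `DetOrbitSymKroneckerBound.lean`),
  transported to the literal `schurRep (stdRep (MatIdx n))` rendering by t03's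
  `finrank_subgroupInvariants_schurRep_stdRep_eq_weylInvariantDim` and to BLMW's `sk` of (5.2.5) by
  `symKroneckerCoeffRect_eq_symKroneckerCoeff` (`BLMW11InvariantDimensionTransport.lean`); the
  divisibility conjunct `BLMW2011_prop_5_2_1_invariants_right` (`BLMW11DegreeDivisibilityProofs.lean`);
  hence `BLMW2011_prop_5_2_1_invariants_iff_symKroneckerCoeff_le`: what remained was `≥`.
* HERE, `≥` as the subspace EQUALITY `((E ⊗ F)^{⊗ md})^{GL(W)(det_m)} = X'`
  (`invariants_linStabilizer_detFormLex_eq_symKronInvariants`): every `S`-fixed tensor is fixed by the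
  whole stabilizer. Following the printed proof: (§5) the stabilizer IS `{a ⊗ b, (a ⊗ b)τ : det a det b
  = 1}` — the tree's PROVED Frobenius theorem `frobenius_detPreserver_unimodular_sandwich_holds`
  (Marcus–Moyls: `X ↦ PXQ` or `PXᵀQ`) rewritten in the word-model letters `kronFin`, `swapGL`
  (`exists_kronFin_of_reindexGL_mem_linStabilizer_detFormLex`); (§3–§4) "to have a trivial
  `SL(E) × SL(F)` action on `S_μE ⊗ S_νF`, we need `μ = ν = (δⁿ)`", i.e. on the slices of an `S`-fixed
  tensor, which lie in `(E^{⊗md})^{U} ∩ weight (d,…,d) = HW_□` (tree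
  `mem_kronInvariants_iff_slices`, `unimodularBorelInvariants_eq_highestWeightSpace`), ALL of `GL(E)`
  acts by `det^d` (`wordRep_eq_det_pow_smul_of_mem_unimodularBorelInvariants`), so `a ⊗ b` acts by
  `(det a det b)^d = 1` (`wordRep_kronFin_of_mem_kronInvariants`). The step "`GL(E)` acts on `HW_□` by
  `det^d`" (in print: `S_{(δⁿ)}E` is the one-dimensional `det^δ`, Schur–Weyl) is proved here WITHOUT the
  Schur–Weyl decomposition, infinitesimally: a highest-weight vector of the rectangular weight is killed
  by every polarisation `E_{ab}`, `a ≠ b` (§1: raising operators by the tree's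
  `wordRaise_eq_zero_of_mem_highestWeightSpace`, lowering ones by the `𝔰𝔩₂`-ladder at `H`-weight `0`,
  `wordRaise_eq_zero_of_isRSSupported_self`, Fulton–Harris §11.1), hence fixed by every root subgroup
  `x_{ab}(t) = exp(t E_{ab})` (§2: the exponential formula `wordRep_transvection_eq_sum` for general `N`,
  extending the tree's `N = 2` case `wordRep_unipotentTwo` of `WordRaisingOperator.lean`;
  Goodman–Wallach §2.3.2), and `GL_m` is generated by transvections and invertible diagonal matrices
  (Mathlib `Matrix.diagonal_transvection_induction_of_det_ne_zero`), the latter acting by `(∏tᵢ)^d`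
  (tree `wordRep_diagonal_of_mem_unimodularBorelInvariants`).
* Consequences: `weylInvariantDim_det_eq_symKroneckerCoeffRect` (`dim {λ}^{H_{det_m}} = sk(λ, m × d)`,
  EQUALITY in t08's `≤`; so chain shape (u) of `Summits/…/BIPWhatWouldSufficeStab.lean`, hypothesis
  `dim {λ}^{H_{det₄}} < L`, and shape (a), hypothesis `sk < L`, coincide on the det side),
  `finrank_subgroupInvariants_det_eq_symKroneckerCoeff` ((5.2.6) literally), and the discharge
  `BLMW2011_prop_5_2_1_invariants_holds` via `BLMW2011_prop_5_2_1_invariants_iff`.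

## References

* [BurgisserEtAl2011] P. Bürgisser, J. M. Landsberg, L. Manivel, J. Weyman, SIAM J. Comput. 40(4)
  (2011), doi:10.1137/090765328, §5.2: (5.2.1) (stabilizer), (5.2.5) (`sk`), Prop. 5.2.1 (5.2.6) and
  its proof ("`(S_π(E⊗F))^{H₀} = ⊕(S_μE ⊗ S_νF)^{H₀}` … `μ = ν = (δⁿ)` … the action of the involution
  `τ` corresponds to the action of `σ^π_{δⁿδⁿ}`"). arXiv:0907.2850v1 numbering: Prop. 5.1, held p0009.
* [MarcusMoyls1959] M. Marcus, B. N. Moyls, *Linear transformations on algebras of matrices*,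
  Canad. J. Math. 11 (1959), Thm. 2 (determinant preservers; tree
  `frobenius_detPreserver_unimodular_sandwich_holds`).
* [FultonHarrisGTM129] W. Fulton, J. Harris, *Representation Theory*, GTM 129 (1991), §11.1
  (11.5)–(11.7) (the `𝔰𝔩₂` ladder), §15.5 (`𝕊_{(d,…,d)} = det^d`).
* [GoodmanWallachGTM255] R. Goodman, N. R. Wallach, *Symmetry, Representations, and Invariants*,
  GTM 255 (2009), §2.3.2 Prop. 2.3.5 (`u(z) = exp(zx)`; `V^{N⁺}`).

## Design

`namespace Literature.Computability.AlgebraicComplexity` (as the parent file and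
`BLMW11InvariantDimensionTransport.lean`); the word-model lemmas of §1–§4 are stated for any field of
characteristic zero, §5–§7 over `ℂ` (the home of Frobenius' theorem and of the named fact). No new
`def`: transvections enter as `g : GL` with `↑g = Matrix.transvection a b t`, the stabilizer of `det_m`
pulled back to `GL (Fin (m·m)) ℂ` along `matIdxEquiv m` exactly as in
`IK2020OrbitClosureInvariantBound.lean` §G. Mathlib: `Matrix.transvection`, `TransvectionStruct`,
`Matrix.diagonal_transvection_induction_of_det_ne_zero`, `GeneralLinearGroup.mkOfDetNeZero`.
-/

noncomputable section

open MvPolynomial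
open scoped BigOperators Matrix Kronecker

namespace Literature.Computability.AlgebraicComplexity

open _root_.Literature.NumberTheory.DiophantineGeometry
open _root_.Literature.RepresentationTheory.GeneralLinear

/-! ### §1 The `𝔰𝔩₂` ladder at `H`-weight zero: `E c = 0 ⟹ F c = 0` -/

section Ladder

variable {k : Type*} [Field k] [CharZero k] {N m : ℕ}

/-- **An `E`-killed vector of `H`-weight zero is `F`-killed** (characteristic zero): if
`c ∈ (k^N)^{⊗m}` (word model) is supported on words with the same number `x` of letters `a` and
`b`, and `E_{a b} c = 0`, then `E_{b a} c = 0`. The `𝔰𝔩₂`-ladder `E F^{j+1} c = (j+1)(λ - j) F^j c`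
(`wordRaise_iterate_succ`, `λ = x - x = 0`) reaches `0` after finitely many steps (no words with a
negative number of letters `a`), and for `j ≥ 1` its coefficient `-(j+1)j` is nonzero, so one may
descend to `F c = 0`. Fulton–Harris §11.1, (11.5)–(11.7) (a highest weight vector of weight `0`
spans the trivial representation); Goodman–Wallach Lemma 2.3.1–2.3.2. [cite: FultonHarrisGTM129, §11.1 (11.5)–(11.7)] -/
theorem wordRaise_eq_zero_of_isRSSupported_self {a b : Fin N} (hab : a ≠ b) {x : ℤ}
    {c : Word N m → k} (h : IsRSSupported a b x x c) (hE : wordRaise k a b c = 0) :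
    wordRaise k b a c = 0 := by
  -- the ladder vanishes far enough down
  have hzero : (wordRaise k b a)^[x.toNat + 1] c = 0 :=
    (h.iterate_lower hab (x.toNat + 1)).eq_zero_of_neg (by omega)
  -- one step of the descent: `F^{n+2} c = 0 ⟹ F^{n+1} c = 0`
  have hdesc : ∀ n : ℕ, (wordRaise k b a)^[n + 2] c = 0 → (wordRaise k b a)^[n + 1] c = 0 := by
    intro n hn
    have h1 := wordRaise_iterate_succ hab h hE (n + 1)
    rw [hn, map_zero] at h1
    refine (smul_eq_zero.1 h1.symm).resolve_left (mul_ne_zero ?_ ?_)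
    · exact_mod_cast Nat.succ_ne_zero (n + 1)
    · rw [sub_self, Int.cast_zero, zero_sub, neg_ne_zero]
      exact_mod_cast Nat.succ_ne_zero n
  -- descend
  have key : ∀ M n : ℕ, (wordRaise k b a)^[n + 1 + M] c = 0 → (wordRaise k b a)^[n + 1] c = 0 := by
    intro M
    induction M with
    | zero => intro n hn; simpa using hn
    | succ M ih =>
      intro n hn
      have h2 : (wordRaise k b a)^[n + M + 2] c = 0 := by
        have hMn : n + M + 2 = n + 1 + (M + 1) := by ring
        rw [hMn]
        exact hn
      have h3 := hdesc (n + M) h2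
      have hMn' : n + 1 + M = n + M + 1 := by ring
      refine ih n ?_
      rw [hMn']
      exact h3
  have h01 : (wordRaise k b a)^[0 + 1] c = 0 := key x.toNat 0 (by rwa [zero_add, add_comm])
  simpa using h01

end Ladder

/-! ### §2 The exponential formula for a transvection on the word model (general `N`) -/

section Exponential

variable (k : Type*) [Field k] {N : ℕ}

/-- The action of `GL_N` on words of length `0` (`(k^N)^{⊗0} = k`) is trivial. [folklore] -/
private theorem wordRep_length_zero (g : GL (Fin N) k) (c : Word N 0 → k) :
    wordRep k N 0 g c = c := by
  funext w
  rw [wordRep_apply, Finset.sum_eq_single w]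
  · simp
  · intro u _ hu
    exact absurd (Subsingleton.elim u w) hu
  · intro h
    exact absurd (Finset.mem_univ w) h

/-- Two vectors of `(k^N)^{⊗(m+1)}` with the same components along the last factor are equal.
[folklore] -/
private theorem wordComp_ext' {m : ℕ} {c c' : Word N (m + 1) → k}
    (h : ∀ i, wordComp k i c = wordComp k i c') : c = c' := by
  rw [← sub_eq_zero]
  exact eq_zero_of_wordComp_eq_zero k (c - c') fun i => by rw [map_sub, h i, sub_self]

/-- **The exponential formula** (characteristic zero, any `N`, `a ≠ b`): the transvection
`x_{ab}(t) = 1 + t e_{ab} ∈ GL_N(k)` acts on words of length `m` by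
`x_{ab}(t) · c = ∑_{r ≤ m} (t^r / r!) • E_{ab}^r c`, `E_{ab}` the tree's polarisation operator
`wordRaise k a b` (`x_{ab}(t) = exp(t E_{ab})`, `E_{ab}^{m+1} = 0`). Proof by induction on `m` through the
last-factor components, exactly as the tree's `N = 2` case `wordRep_unipotentTwo`
(`WordRaisingOperator.lean`): `(x·c)_i = x·c_i + [i = a] t • x·c_b` (`wordComp_wordRep`) against
`(E^r c)_i = E^r c_i + [i = a] r • E^{r-1} c_b` (`wordComp_wordRaise_pow_of_ne/_self`).
Goodman–Wallach §2.3.2 (proof of Prop. 2.3.5, `u(z) = exp(zx)`); Fulton, *Young Tableaux*, §8.2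
(the action of `1 + t E_{ij}`). [cite: GoodmanWallachGTM255, §2.3.2 Prop. 2.3.5 (proof)] -/
theorem wordRep_transvection_eq_sum [CharZero k] {a b : Fin N} (hab : a ≠ b) (t : k) :
    ∀ {m : ℕ} (g : GL (Fin N) k)
      (_hg : (g : Matrix (Fin N) (Fin N) k) = Matrix.transvection a b t) (c : Word N m → k),
      wordRep k N m g c =
        ∑ r ∈ Finset.range (m + 1), (t ^ r / (r.factorial : k)) • (wordRaise k a b ^ r) c := by
  intro m
  induction m with
  | zero =>
      intro g _ c
      rw [wordRep_length_zero, Finset.sum_range_one]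
      simp
  | succ m ih =>
      intro g hg c
      have hba : b ≠ a := Ne.symm hab
      -- entries of the transvection
      have hgij : ∀ i j : Fin N, (g : Matrix (Fin N) (Fin N) k) i j =
          (if i = j then 1 else 0) + (if a = i ∧ b = j then t else 0) := by
        intro i j
        rw [hg, Matrix.transvection, Matrix.add_apply, Matrix.one_apply, Matrix.single_apply]
      refine wordComp_ext' k fun i => ?_
      rw [wordComp_wordRep, map_sum]
      simp only [map_smul]
      -- split the sum `∑_j g_{ij} • x·c_j` into the diagonal term and the `(a,b)` term
      have hsum : ∑ j, (g : Matrix (Fin N) (Fin N) k) i j • wordRep k N m g (wordComp k j c) =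
          wordRep k N m g (wordComp k i c) +
            (if i = a then t • wordRep k N m g (wordComp k b c) else 0) := by
        simp_rw [hgij, add_smul, Finset.sum_add_distrib]
        congr 1
        · rw [Finset.sum_eq_single i]
          · rw [if_pos rfl, one_smul]
          · intro j _ hj
            rw [if_neg (Ne.symm hj), zero_smul]
          · intro h; exact absurd (Finset.mem_univ i) h
        · by_cases hi : i = a
          · rw [if_pos hi, Finset.sum_eq_single b]
            · rw [if_pos ⟨hi.symm, rfl⟩]
            · intro j _ hj
              rw [if_neg (fun h => hj h.2.symm), zero_smul]
            · intro h; exact absurd (Finset.mem_univ b) h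
          · rw [if_neg hi]
            exact Finset.sum_eq_zero fun j _ => by rw [if_neg (fun h => hi h.1.symm), zero_smul]
      rw [hsum, ih g hg, ih g hg]
      by_cases hi : i = a
      · subst hi
        rw [if_pos rfl]
        simp only [wordComp_wordRaise_pow_self k hba, smul_add]
        rw [Finset.sum_add_distrib]
        congr 1
        · -- the `r = m+1` term of `∑ (t^r/r!) • E^r c_a` vanishes
          rw [Finset.sum_range_succ (fun r => (t ^ r / (r.factorial : k)) • (wordRaise k i b ^ r) _)
              (m + 1), wordRaise_pow_apply_eq_zero k hab _ (Nat.lt_succ_self m), smul_zero, add_zero]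
        · -- reindex `r ↦ r + 1`
          rw [Finset.sum_range_succ' (fun r => (t ^ r / (r.factorial : k)) •
              ((r : k) • (wordRaise k i b ^ (r - 1)) _)) (m + 1)]
          simp only [Nat.cast_zero, zero_smul, smul_zero, add_zero, Nat.add_sub_cancel,
            Finset.smul_sum, smul_smul]
          refine Finset.sum_congr rfl fun r _ => ?_
          congr 1
          have hr : ((r.factorial : ℕ) : k) ≠ 0 := by exact_mod_cast r.factorial_ne_zero
          have hr1 : ((r + 1 : ℕ) : k) ≠ 0 := by exact_mod_cast Nat.succ_ne_zero r
          rw [Nat.factorial_succ]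
          push_cast
          field_simp
          ring
      · rw [if_neg hi, add_zero]
        simp only [wordComp_wordRaise_pow_of_ne k hi]
        rw [Finset.sum_range_succ (fun r => (t ^ r / (r.factorial : k)) • (wordRaise k a b ^ r) _)
            (m + 1), wordRaise_pow_apply_eq_zero k hab _ (Nat.lt_succ_self m), smul_zero, add_zero]

/-- **An `E_{ab}`-killed vector is fixed by the root subgroup `x_{ab}(t)`** (`a ≠ b`, characteristic
zero): `E_{ab} c = 0 ⟹ x_{ab}(t) · c = c` (only the `r = 0` term of the exponential formula
survives). Goodman–Wallach §2.3.2, Prop. 2.3.5 (2) (`V^{N⁺}`). [cite: GoodmanWallachGTM255, §2.3.2 Prop. 2.3.5] -/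
theorem wordRep_transvection_of_wordRaise_eq_zero [CharZero k] {a b : Fin N} (hab : a ≠ b) (t : k)
    {m : ℕ} (g : GL (Fin N) k) (hg : (g : Matrix (Fin N) (Fin N) k) = Matrix.transvection a b t)
    {c : Word N m → k} (hc : wordRaise k a b c = 0) : wordRep k N m g c = c := by
  rw [wordRep_transvection_eq_sum k hab t g hg, Finset.sum_eq_single 0]
  · simp
  · intro r _ hr
    obtain ⟨r, rfl⟩ := Nat.exists_eq_succ_of_ne_zero hr
    rw [show (wordRaise k a b ^ r.succ) c = (wordRaise k a b ^ r) (wordRaise k a b c) by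
      rw [pow_succ, Module.End.mul_apply], hc, map_zero, smul_zero]
  · intro h
    exact absurd (Finset.mem_range.2 (Nat.succ_pos m)) h

end Exponential

/-! ### §3 `GL_m` acts on the highest-weight vectors of the rectangular weight by `det^d` -/

section Rectangle

variable (k : Type*) [Field k] [CharZero k] {m d : ℕ}

/-- **Highest-weight vectors of the rectangular weight `□ = (d, …, d)` are killed by EVERY
polarisation `E_{ab}`, `a ≠ b`** (characteristic zero): for `a < b` this is the tree's
`wordRaise_eq_zero_of_mem_highestWeightSpace` (raising operators kill highest-weight vectors); for
`a > b` the vector has `H_{ba}`-weight `□_b - □_a = 0`, so the `𝔰𝔩₂`-ladder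
(`wordRaise_eq_zero_of_isRSSupported_self`) applies. BLMW 2011 §5.2 (proof of Prop. 5.2.1: "To have
a trivial `SL(E)`-action … we need `μ = (δⁿ)`"); Fulton–Harris §15.5 (`𝕊_{(d,…,d)} = det^d`).
[cite: BurgisserEtAl2011, Prop. 5.2.1 (proof)] -/
theorem wordRaise_eq_zero_of_mem_unimodularBorelInvariants {y : Word m (m * d) → k}
    (hy : y ∈ unimodularBorelInvariants k m (m * d)) {a b : Fin m} (hab : a ≠ b) :
    wordRaise k a b y = 0 := by
  rw [unimodularBorelInvariants_eq_highestWeightSpace] at hy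
  rcases lt_or_gt_of_ne hab with h | h
  · exact wordRaise_eq_zero_of_mem_highestWeightSpace h hy
  · have hE : wordRaise k b a y = 0 := wordRaise_eq_zero_of_mem_highestWeightSpace h hy
    have hsupp : IsRSSupported b a (d : ℤ) (d : ℤ) y := by
      intro w hw
      constructor
      · by_contra hne
        refine hw (apply_eq_zero_of_mem_highestWeightSpace k hy (i := b) ?_)
        rwa [Weight.ofPartition_rectangle_apply]
      · by_contra hne
        refine hw (apply_eq_zero_of_mem_highestWeightSpace k hy (i := a) ?_)
        rwa [Weight.ofPartition_rectangle_apply]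
    exact wordRaise_eq_zero_of_isRSSupported_self (Ne.symm hab) hsupp hE

/-- **Transvections fix the highest-weight vectors of the rectangular weight** (characteristic
zero): `x_{ab}(t) · y = y` for `a ≠ b` (`E_{ab} y = 0` and the exponential formula).
[cite: BurgisserEtAl2011, Prop. 5.2.1 (proof)] -/
theorem wordRep_transvection_of_mem_unimodularBorelInvariants {y : Word m (m * d) → k}
    (hy : y ∈ unimodularBorelInvariants k m (m * d)) {a b : Fin m} (hab : a ≠ b) (t : k)
    (g : GL (Fin m) k) (hg : (g : Matrix (Fin m) (Fin m) k) = Matrix.transvection a b t) :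
    wordRep k m (m * d) g y = y :=
  wordRep_transvection_of_wordRaise_eq_zero k hab t g hg
    (wordRaise_eq_zero_of_mem_unimodularBorelInvariants k hy hab)

/-- **`GL(E)` acts on `(E^{⊗ m d})^{U(E)} ∩ (weight (d,…,d)) = HW_□` by the character `det^d`**
(characteristic zero): a vector of `E^{⊗ m d}` fixed by the unimodular upper triangular matrices is
a semi-invariant of ALL of `GL_m`, `g · y = det(g)^d y`; in particular it is fixed by `SL_m`. Proof:
`GL_m` is generated by invertible diagonal matrices and transvections
(Mathlib `Matrix.diagonal_transvection_induction_of_det_ne_zero`); diagonal matrices act by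
`(∏ tᵢ)^d` (tree `wordRep_diagonal_of_mem_unimodularBorelInvariants`), transvections trivially
(`wordRep_transvection_of_mem_unimodularBorelInvariants`). This is the step "`(S_μ E)^{SL(E)} ≠ 0`
only for `μ = (δⁿ)`, where `S_{(δⁿ)}E = (det E)^{⊗δ}`" of BLMW's proof of Prop. 5.2.1; Fulton–Harris
§15.5. [cite: BurgisserEtAl2011, Prop. 5.2.1 (proof)] -/
theorem wordRep_eq_det_pow_smul_of_mem_unimodularBorelInvariants {y : Word m (m * d) → k}
    (hy : y ∈ unimodularBorelInvariants k m (m * d)) (g : GL (Fin m) k) :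
    wordRep k m (m * d) g y = ((g : Matrix (Fin m) (Fin m) k).det ^ d) • y := by
  have hdet : (g : Matrix (Fin m) (Fin m) k).det ≠ 0 :=
    Matrix.det_ne_zero_of_right_inverse (B := ((g⁻¹ : GL (Fin m) k) : Matrix (Fin m) (Fin m) k))
      (by rw [← Units.val_mul, mul_inv_cancel, Units.val_one])
  suffices H : ∀ M : Matrix (Fin m) (Fin m) k, M.det ≠ 0 → ∀ g : GL (Fin m) k,
      (g : Matrix (Fin m) (Fin m) k) = M → wordRep k m (m * d) g y = (M.det ^ d) • y from
    H _ hdet g rfl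
  intro M hM
  refine Matrix.diagonal_transvection_induction_of_det_ne_zero
    (fun M => ∀ g : GL (Fin m) k, (g : Matrix (Fin m) (Fin m) k) = M →
      wordRep k m (m * d) g y = (M.det ^ d) • y) M hM ?_ ?_ ?_
  · -- diagonal matrices
    intro D hD g hg
    have hg' : g = Matrix.GeneralLinearGroup.mkOfDetNeZero _ hD :=
      Units.ext (by rw [hg, Matrix.GeneralLinearGroup.val_mkOfDetNeZero])
    rw [hg', wordRep_diagonal_of_mem_unimodularBorelInvariants k hy D hD, Matrix.det_diagonal]
  · -- transvections
    intro t g hg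
    rw [Matrix.TransvectionStruct.det, one_pow, one_smul]
    exact wordRep_transvection_of_mem_unimodularBorelInvariants k hy t.hij t.c g hg
  · -- products
    intro A B hA hB hPA hPB g hg
    set gA : GL (Fin m) k := Matrix.GeneralLinearGroup.mkOfDetNeZero A hA with hgA
    set gB : GL (Fin m) k := Matrix.GeneralLinearGroup.mkOfDetNeZero B hB with hgB
    have hgAB : g = gA * gB := Units.ext (by
      rw [hg, Units.val_mul, hgA, hgB, Matrix.GeneralLinearGroup.val_mkOfDetNeZero,
        Matrix.GeneralLinearGroup.val_mkOfDetNeZero])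
    rw [hgAB, map_mul, Module.End.mul_apply,
      hPB gB (by rw [hgB, Matrix.GeneralLinearGroup.val_mkOfDetNeZero]), map_smul,
      hPA gA (by rw [hgA, Matrix.GeneralLinearGroup.val_mkOfDetNeZero]), smul_smul,
      Matrix.det_mul, mul_pow, mul_comm (B.det ^ d)]

end Rectangle

/-! ### §4 `a ⊗ b` with `(det a · det b)^d = 1` fixes the Kronecker invariants of degree `m d` -/

section KronFixed

variable (k : Type*) [Field k] [CharZero k] {m d : ℕ}

/-- **The Kronecker invariants of degree `m·d` are fixed by every `a ⊗ b` with
`(det a · det b)^d = 1`** — in particular by `H₀ = S(GL(E) × GL(F))` (characteristic zero): a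
vector of `(E ⊗ F)^{⊗ md}` fixed by the unimodular upper triangular `a ⊗ b` has all its slices in
`HW_□` (`mem_kronInvariants_iff_slices`), on which `GL_m` acts by `det^d`
(`wordRep_eq_det_pow_smul_of_mem_unimodularBorelInvariants`), so `a ⊗ b` acts by
`det(a)^d det(b)^d` (`M ↦ a^{⊗D} M (b^{⊗D})ᵀ`, `splitFun_wordRep_kronFin_eq`). BLMW 2011, proof of
Prop. 5.2.1 ("`(S_π(E ⊗ F))^{H₀} = ⊕ (S_μE ⊗ S_νF)^{H₀}` … `μ = ν = (δⁿ)`").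
[cite: BurgisserEtAl2011, Prop. 5.2.1 (proof)] -/
theorem wordRep_kronFin_of_mem_kronInvariants {x : Word (m * m) (m * d) → k}
    (hx : x ∈ kronInvariants k m (m * d)) (a b : GL (Fin m) k)
    (hab : ((a : Matrix (Fin m) (Fin m) k).det * (b : Matrix (Fin m) (Fin m) k).det) ^ d = 1) :
    wordRep k (m * m) (m * d) (kronFin k m a b) x = x := by
  obtain ⟨hcol, hrow⟩ := (mem_kronInvariants_iff_slices k x).1 hx
  apply (splitFun k m (m * d)).injective
  rw [splitFun_wordRep_kronFin_eq]
  funext uv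
  obtain ⟨u, v⟩ := uv
  have hright : (fun u' => rightKronAct k (b : Matrix (Fin m) (Fin m) k) (splitFun k m (m * d) x)
      (u', v)) = ((b : Matrix (Fin m) (Fin m) k).det ^ d) • fun u' => splitFun k m (m * d) x (u', v) := by
    funext u'
    rw [rightKronAct_apply, wordRep_eq_det_pow_smul_of_mem_unimodularBorelInvariants k (hrow u') b]
    rfl
  rw [leftKronAct_apply, hright, map_smul,
    wordRep_eq_det_pow_smul_of_mem_unimodularBorelInvariants k (hcol v) a, smul_smul, ← mul_pow,
    mul_comm ((b : Matrix (Fin m) (Fin m) k).det), hab, one_smul]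

end KronFixed

/-! ### §5 Frobenius: the stabilizer of `det_m` in `GL_{m²}` consists of `a ⊗ b` and `(a ⊗ b)·τ` -/

section Frobenius

variable {m : ℕ}

/-- Entries of the elementary matrix supported at `cd`, written through `toLex` (private helper).
[folklore] -/
private theorem of_single_toLex_apply (cd : Fin m × Fin m) (i j : Fin m) :
    Matrix.of (fun a b => (Pi.single (toLex cd) (1 : ℂ) : MatIdx m → ℂ) (toLex (a, b))) i j =
      if i = cd.1 ∧ j = cd.2 then (1 : ℂ) else 0 := by
  rw [Matrix.of_apply, Pi.single_apply]
  simp only [EmbeddingLike.apply_eq_iff_eq, Prod.ext_iff]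

/-- `P · E_{cd} · Q` entrywise: `(P X Q)_{a b} = P_{a c} Q_{d b}` for the elementary matrix `X`
supported at `cd = (c, d)` (private helper). [folklore] -/
private theorem mul_of_single_mul_apply (P Q : Matrix (Fin m) (Fin m) ℂ) (cd : Fin m × Fin m)
    (a₀ b₀ : Fin m) :
    (P * Matrix.of (fun a b => (Pi.single (toLex cd) (1 : ℂ) : MatIdx m → ℂ) (toLex (a, b)))
        * Q) a₀ b₀ = P a₀ cd.1 * Q cd.2 b₀ := by
  rw [Matrix.mul_assoc, Matrix.mul_apply, Finset.sum_eq_single cd.1]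
  · rw [Matrix.mul_apply, Finset.sum_eq_single cd.2]
    · rw [of_single_toLex_apply, if_pos ⟨rfl, rfl⟩, one_mul]
    · intro j _ hj
      rw [of_single_toLex_apply, if_neg (fun h => hj h.2), zero_mul]
    · intro h; exact absurd (Finset.mem_univ _) h
  · intro i _ hi
    rw [Matrix.mul_apply, Finset.sum_eq_zero (fun j _ => by
      rw [of_single_toLex_apply, if_neg (fun h => hi h.1), zero_mul]), mul_zero]
  · intro h; exact absurd (Finset.mem_univ _) h

/-- Transposed variant: `(P Xᵀ Q)_{a b} = P_{a d} Q_{c b}` (private helper). [folklore] -/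
private theorem mul_of_single_transpose_mul_apply (P Q : Matrix (Fin m) (Fin m) ℂ)
    (cd : Fin m × Fin m) (a₀ b₀ : Fin m) :
    (P * (Matrix.of (fun a b => (Pi.single (toLex cd) (1 : ℂ) : MatIdx m → ℂ)
        (toLex (a, b))))ᵀ * Q) a₀ b₀ = P a₀ cd.2 * Q cd.1 b₀ := by
  have hT : (Matrix.of (fun a b => (Pi.single (toLex cd) (1 : ℂ) : MatIdx m → ℂ)
      (toLex (a, b))))ᵀ =
      Matrix.of (fun a b => (Pi.single (toLex (cd.2, cd.1)) (1 : ℂ) : MatIdx m → ℂ)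
        (toLex (a, b))) := by
    ext a b
    rw [Matrix.transpose_apply, of_single_toLex_apply, of_single_toLex_apply]
    by_cases h : b = cd.1 ∧ a = cd.2
    · rw [if_pos h, if_pos ⟨h.2, h.1⟩]
    · rw [if_neg h, if_neg (fun h' => h ⟨h'.2, h'.1⟩)]
  rw [hT, mul_of_single_mul_apply]

/-- The swap read through the enumeration `finProdFinEquiv` (private helper). [folklore] -/
private theorem finProdFinEquiv_symm_swapPerm (n : Fin (m * m)) :
    finProdFinEquiv.symm (swapPerm m n) = ((finProdFinEquiv.symm n).2, (finProdFinEquiv.symm n).1) := by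
  obtain ⟨⟨i, j⟩, rfl⟩ := finProdFinEquiv.surjective n
  rw [swapPerm_apply, Equiv.symm_apply_apply, Equiv.symm_apply_apply]

/-- The `toLex (a, b)` entry of `Mᵀ · e_{e n}` for `M = reindex e e h` (`e = matIdxEquiv m`) is the
entry `h n (e⁻¹ (toLex (a, b)))` (private helper). [folklore] -/
private theorem transpose_reindex_mulVec_single (h : GL (Fin (m * m)) ℂ) (n : Fin (m * m))
    (q : Fin m × Fin m) :
    ((((reindexGL (k := ℂ) (matIdxEquiv m) h : GL (MatIdx m) ℂ) : Matrix (MatIdx m) (MatIdx m) ℂ))ᵀ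
        *ᵥ (Pi.single (matIdxEquiv m n) (1 : ℂ))) (toLex q) =
      (h : Matrix (Fin (m * m)) (Fin (m * m)) ℂ) n (finProdFinEquiv q) := by
  rw [Matrix.mulVec, dotProduct, Finset.sum_eq_single (matIdxEquiv m n)]
  · rw [Pi.single_eq_same, mul_one, Matrix.transpose_apply, coe_reindexGL, Matrix.submatrix_apply,
      OrderIso.symm_apply_apply]
    rfl
  · intro p _ hp
    rw [Pi.single_eq_of_ne hp, mul_zero]
  · intro hn; exact absurd (Finset.mem_univ _) hn

/-- **Frobenius' theorem for the stabilizer of `det_m` in `GL_{m²}`, Kronecker form**: an element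
`h ∈ GL (Fin (m·m)) ℂ` whose lexicographic reindexing stabilizes `detFormLex ℂ m` is `a ⊗ b` or
`(a ⊗ b) · τ` (`τ = swapGL`, the transposition) with `det a · det b = 1` — the tree's PROVED
`frobenius_detPreserver_unimodular_sandwich_holds` (Marcus–Moyls: `X ↦ P X Q` or `X ↦ P Xᵀ Q`,
`det P = det Q = 1`) rewritten in the letters `kronFin` / `swapGL` of the word model
(`a = Pᵀ, b = Q`, resp. `a = Q, b = Pᵀ`). BLMW 2011, (5.2.1): "`GL(W)(det_n) = S(GL(E) × GL(F)) ⋊ ℤ₂`".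
[cite: BurgisserEtAl2011, §5.2 (5.2.1)] [cite: MarcusMoyls1959, Thm. 2] -/
theorem exists_kronFin_of_reindexGL_mem_linStabilizer_detFormLex (h : GL (Fin (m * m)) ℂ)
    (hh : reindexGL (k := ℂ) (matIdxEquiv m) h ∈ linStabilizer (detFormLex ℂ m)) :
    ∃ a b : GL (Fin m) ℂ,
      (a : Matrix (Fin m) (Fin m) ℂ).det * (b : Matrix (Fin m) (Fin m) ℂ).det = 1 ∧
        (h = kronFin ℂ m a b ∨ h = kronFin ℂ m a b * swapGL ℂ m) := by
  rw [mem_linStabilizer, linSubstRep_apply] at hh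
  obtain ⟨P, Q, hP, hQ, hPQ⟩ := frobenius_detPreserver_unimodular_sandwich_holds m _ hh
  have hPt : (Pᵀ).det ≠ 0 := by rw [Matrix.det_transpose, hP]; exact one_ne_zero
  have hQ0 : Q.det ≠ 0 := by rw [hQ]; exact one_ne_zero
  set p : GL (Fin m) ℂ := Matrix.GeneralLinearGroup.mkOfDetNeZero _ hPt with hp
  set q : GL (Fin m) ℂ := Matrix.GeneralLinearGroup.mkOfDetNeZero _ hQ0 with hq
  have hpv : (p : Matrix (Fin m) (Fin m) ℂ) = Pᵀ := by
    rw [hp, Matrix.GeneralLinearGroup.val_mkOfDetNeZero]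
  have hqv : (q : Matrix (Fin m) (Fin m) ℂ) = Q := by
    rw [hq, Matrix.GeneralLinearGroup.val_mkOfDetNeZero]
  -- the entries of `h` from the sandwich identity tested on the basis vectors
  have hentry : ∀ n n' : Fin (m * m),
      (h : Matrix (Fin (m * m)) (Fin (m * m)) ℂ) n n' =
        (Matrix.of fun a b => ((((reindexGL (k := ℂ) (matIdxEquiv m) h : GL (MatIdx m) ℂ) :
            Matrix (MatIdx m) (MatIdx m) ℂ))ᵀ *ᵥ (Pi.single (matIdxEquiv m n) (1 : ℂ))) (toLex (a, b)))
          (finProdFinEquiv.symm n').1 (finProdFinEquiv.symm n').2 := by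
    intro n n'
    rw [Matrix.of_apply, transpose_reindex_mulVec_single, Prod.mk.eta, Equiv.apply_symm_apply]
  rcases hPQ with hPQ | hPQ
  · refine ⟨p, q, by rw [hpv, hqv, Matrix.det_transpose, hP, hQ, one_mul], Or.inl ?_⟩
    refine Units.ext (Matrix.ext fun n n' => ?_)
    rw [hentry, hPQ, matIdxEquiv_apply, mul_of_single_mul_apply, coe_kronFin, kronFinMat_apply, hpv,
      hqv, Matrix.transpose_apply]
  · refine ⟨q, p, by rw [hpv, hqv, Matrix.det_transpose, hP, hQ, one_mul], Or.inr ?_⟩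
    refine Units.ext (Matrix.ext fun n n' => ?_)
    rw [hentry, hPQ, matIdxEquiv_apply, mul_of_single_transpose_mul_apply, Units.val_mul, coe_kronFin,
      coe_swapGL, Matrix.mul_apply, Finset.sum_eq_single (swapPerm m n')]
    · rw [permMatrix_apply', if_pos (by
        rw [← Equiv.Perm.mul_apply, swapPerm_mul_self, Equiv.Perm.one_apply]), mul_one,
        kronFinMat_apply, hpv, hqv, Matrix.transpose_apply, finProdFinEquiv_symm_swapPerm]
      exact mul_comm _ _
    · intro l _ hl
      rw [permMatrix_apply', if_neg, mul_zero]
      intro hln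
      apply hl
      rw [← hln, ← Equiv.Perm.mul_apply, swapPerm_mul_self, Equiv.Perm.one_apply]
    · intro hn; exact absurd (Finset.mem_univ _) hn

end Frobenius

/-! ### §6 `((E ⊗ F)^{⊗ md})^{GL(W)(det_m)} = symKronInvariants`; the dimension formulas -/

section Invariants

variable (m d : ℕ)

/-- **The symmetric Kronecker invariants are fixed by the whole stabilizer of `det_m`** (over `ℂ`):
`X' = ((E ⊗ F)^{⊗ md})^{S} ⊆ ((E ⊗ F)^{⊗ md})^{GL(W)(det_m)}` for the tree's stabilizing family
`S` = {unimodular upper triangular `a ⊗ b`} ∪ {`τ`}. Every stabilizer element is `a ⊗ b` or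
`(a ⊗ b)τ` with `det a det b = 1` (`exists_kronFin_of_reindexGL_mem_linStabilizer_detFormLex`), and
these fix `X'` (`wordRep_kronFin_of_mem_kronInvariants`, and `τ` by definition of `X'`). BLMW 2011,
proof of Prop. 5.2.1. [cite: BurgisserEtAl2011, Prop. 5.2.1 (proof)] -/
theorem symKronInvariants_le_invariants_linStabilizer_detFormLex :
    symKronInvariants ℂ m (m * d) ≤
      Representation.invariants ((wordRep ℂ (m * m) (m * d)).comp
        (((linStabilizer (detFormLex ℂ m)).comap (reindexGL (k := ℂ) (matIdxEquiv m))).subtype)) := by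
  intro x hx
  rw [Representation.mem_invariants]
  rintro ⟨h, hh⟩
  rw [Subgroup.mem_comap] at hh
  obtain ⟨hK, hS⟩ := (mem_symKronInvariants_iff x).1 hx
  obtain ⟨a, b, hab, hcases⟩ := exists_kronFin_of_reindexGL_mem_linStabilizer_detFormLex h hh
  have hfix : wordRep ℂ (m * m) (m * d) (kronFin ℂ m a b) x = x :=
    wordRep_kronFin_of_mem_kronInvariants ℂ hK a b (by rw [hab, one_pow])
  change wordRep ℂ (m * m) (m * d) h x = x
  rcases hcases with rfl | rfl
  · exact hfix
  · rw [map_mul, Module.End.mul_apply, hS, hfix]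

/-- **`((E ⊗ F)^{⊗ md})^{GL(W)(det_m)} = X'`** (over `ℂ`): the tensors fixed by the stabilizer of the
determinant (pulled back to `GL_{m²}` along the lexicographic enumeration `matIdxEquiv m`) are
exactly the tree's symmetric Kronecker invariants `symKronInvariants ℂ m (m d)` of
`DetOrbitSymKroneckerBound.lean` (`⊇`: the previous theorem; `⊆`: the family `S` lies in the
stabilizer, tree `linSubstRep_reindexGL_kronFin_detFormLex`, `linSubstRep_reindexGL_swapGL_detFormLex`).
BLMW 2011, proof of Prop. 5.2.1 (`(S_π(E ⊗ F))^H`, `H = H₀ ⋊ ℤ₂`).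
[cite: BurgisserEtAl2011, Prop. 5.2.1 (proof)] -/
theorem invariants_linStabilizer_detFormLex_eq_symKronInvariants :
    Representation.invariants ((wordRep ℂ (m * m) (m * d)).comp
        (((linStabilizer (detFormLex ℂ m)).comap (reindexGL (k := ℂ) (matIdxEquiv m))).subtype)) =
      symKronInvariants ℂ m (m * d) := by
  refine le_antisymm (fun x hx => ?_) (symKronInvariants_le_invariants_linStabilizer_detFormLex m d)
  rw [Representation.mem_invariants] at hx
  intro h hh
  have hmem : reindexGL (k := ℂ) (matIdxEquiv m) h ∈ linStabilizer (detFormLex ℂ m) := by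
    rw [mem_linStabilizer]
    rcases hh with ⟨a, b, ha, ha1, hb, hb1, rfl⟩ | rfl
    · exact linSubstRep_reindexGL_kronFin_detFormLex ℂ m ha1 hb1
    · exact linSubstRep_reindexGL_swapGL_detFormLex ℂ m
  exact hx ⟨h, hmem⟩

open IK2020 in
/-- **`dim {λ}^{GL(W)(det_m)} = sk(λ, m × d)`** (over `ℂ`, `λ ⊢ m·d`, `ℓ(λ) ≤ m²`): the dimension of the
stabilizer invariants of the Weyl module `{λ}` of `GL_{m²}` equals the tree's rectangular symmetric
Kronecker coefficient `symKroneckerCoeffRect ℂ m d λ` — EQUALITY in t08's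
`IK2020.weylInvariantDim_det_le_symKroneckerCoeffRect` (`dim {λ}^H = dim T_H`,
`IK2020.finrank_boundSpace_invariants_eq_weylInvariantDim`, and `X_H = X'`). BLMW 2011, Prop. 5.2.1
(5.2.6) with (4.1.2): "`dim (S_π(E ⊗ F))^H = sk^π_{δⁿδⁿ}`". [cite: BurgisserEtAl2011, Prop. 5.2.1 (5.2.6)] -/
theorem weylInvariantDim_det_eq_symKroneckerCoeffRect {m d : ℕ} (lam : Nat.Partition (m * d))
    (hlam : lam.parts.card ≤ m * m) :
    weylInvariantDim ℂ (m * m) lam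
        ((linStabilizer (detFormLex ℂ m)).comap (reindexGL (k := ℂ) (matIdxEquiv m))) =
      symKroneckerCoeffRect ℂ m d lam := by
  rw [← finrank_boundSpace_invariants_eq_weylInvariantDim ℂ _ lam hlam,
    invariants_linStabilizer_detFormLex_eq_symKronInvariants]
  rfl

/-- **BLMW 2011, Prop. 5.2.1, (5.2.6) — the dimension formula in the literal rendering of the named
fact**: for `π ⊢ nδ` with `ℓ(π) ≤ n²`,
`dim (S_πW)^{GL(W)(det_n)} = sk^π_{δⁿδⁿ} = symKroneckerCoeff ℂ π (δⁿ)` (`W = ℂ^{n×n}`,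
`S_πW = schurRep (stdRep (MatIdx n) ℂ) π`): `weylInvariantDim_det_eq_symKroneckerCoeffRect` moved to
the `schurRep` rendering by t03's `finrank_subgroupInvariants_schurRep_stdRep_eq_weylInvariantDim` and
to BLMW's `sk` of (5.2.5) by `symKroneckerCoeffRect_eq_symKroneckerCoeff`.
[cite: BurgisserEtAl2011, Prop. 5.2.1 (5.2.6)] -/
theorem finrank_subgroupInvariants_det_eq_symKroneckerCoeff {n δ : ℕ} (π : Nat.Partition (n * δ))
    (hπ : π.parts.card ≤ n * n) :
    Module.finrank ℂ (subgroupInvariants (V := schurModule ℂ (MatIdx n → ℂ) π)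
        (schurRep (stdRep (MatIdx n) ℂ) π) (linStabilizer (detFormLex ℂ n))) =
      symKroneckerCoeff ℂ π (Nat.Partition.rectangle n δ) := by
  rw [finrank_subgroupInvariants_schurRep_stdRep_eq_weylInvariantDim (matIdxEquiv n),
    weylInvariantDim_det_eq_symKroneckerCoeffRect π hπ, symKroneckerCoeffRect_eq_symKroneckerCoeff ℂ π hπ]

end Invariants

/-! ### §7 The discharge -/

/-- **Discharge of the named fact `BLMW2011_prop_5_2_1_invariants`** (BLMW 2011, Prop. 5.2.1,
(5.2.6) via (4.1.2): "`ℂ[GL(W)·det_n] = ⊕_{δ ≥ 0} ⊕_{π : |π| = nδ} (S_πW^*)^{⊕ sk^π_{δⁿδⁿ}}`", i.e.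
`dim (S_π(E ⊗ F))^{GL(W)(det_n)} = sk^π_{δⁿδⁿ}` for `π ⊢ nδ`, `ℓ(π) ≤ n²`, and the invariants vanish
when `n ∤ |π|`): the first conjunct is `finrank_subgroupInvariants_det_eq_symKroneckerCoeff`, the
second the tree's `BLMW2011_prop_5_2_1_invariants_right` (`BLMW11DegreeDivisibilityProofs.lean`),
assembled by `BLMW2011_prop_5_2_1_invariants_iff`. The printed proof is followed: Frobenius'
stabilizer `H = S(GL(E) × GL(F)) ⋊ ℤ₂` (tree `frobenius_detPreserver_unimodular_sandwich_holds`),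
`(S_μE)^{SL(E)}` nonzero only for the rectangle where `GL(E)` acts by `det^δ` (§3, via polarisation
operators and root subgroups instead of the Peter–Weyl/Schur–Weyl decomposition), the involution
`τ` acting as `σ^π_{δⁿδⁿ}` (the tree's `symKronInvariants ≃ Sym²(HW_□)` and its character,
`DetOrbitSymKroneckerBound.lean`). [cite: BurgisserEtAl2011, Prop. 5.2.1 (5.2.6)] -/
theorem BLMW2011_prop_5_2_1_invariants_holds : BLMW2011_prop_5_2_1_invariants :=
  BLMW2011_prop_5_2_1_invariants_iff.2 fun _ _ π hπ =>
    finrank_subgroupInvariants_det_eq_symKroneckerCoeff π hπ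

end Literature.Computability.AlgebraicComplexity
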